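import Summits.CriticalPhenomena.PercolationContinuityZ3.Theorems.SahiMasterFamilyStructMain
import Summits.CriticalPhenomena.PercolationContinuityZ3.Theorems.SahiMasterFamilyEqImpliesNonneg

/-!
# The master conjecture at every order: what the all-order step leaves open

Unit `prim-master-conj` (crux anchor stmt-CriticalPhenomena-4575), gen 7.  `SahiMasterFamilyStructMain.masterFamily_step_all`
(gen 6) settles, at EVERY order and unconditionally, every family of increasing events that contains a zero-flag sub-family:
`E ≥ 0`, and in the open cube `E = 0 ↔ Z`.  This file records the resulting logical position of the three master statements
(`MasterFamilyNonneg k` = Sahi's `C_k` for product measures, `MasterFamilyEqIff k` = pointwise zero locus, `MasterFamilyIdentEqIff k`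
= identically-zero locus) at every order `k ≥ 3`, replacing the order-by-order corollaries `masterFamilyEqIff_four_iff`,
`masterFamilyIdentEqIff_four_iff` (FourStep), `…_five_iff` (FiveEq):

* `masterFamilyEqIff_iff_zero_forces_flag n`: `MasterFamilyEqIff (n+3)` ⟺ "an interior zero of `E_{n+3}` forces a `Z_{n+2}`
  sub-family";  `masterFamilyEqIff_iff_heredity_of_eqIff`: given `MasterFamilyEqIff (n+2)` it is ⟺ `MasterFamilyHeredity (n+3)`
  (the tree's `masterFamilyEqIff_iff_heredity` needed `MasterFamilyNonneg (n+2)` as well).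
* `masterFamilyEqIff_all_of_heredity_all`, `masterFamilyNonneg_all_of_heredity_all`: heredity of zeros at every order `≥ 3`
  implies the pointwise equality conjecture AND Sahi positivity `C_k` for product measures at every order (also the truncated
  forms `…_of_heredity_upTo`).
* `masterFamilyIdentEqIff_iff_nonvanishing n`: `MasterFamilyIdentEqIff (n+3)` ⟺ **(T_{n+3})** "`n+3` increasing events with NO
  `Z_{n+2}` sub-family have `E_{n+3}(μ_p) ≠ 0` for some interior `p`" — with no lower-order hypothesis at all;
  `masterFamilyIdentEqIff_iff_identHeredity`: given `MasterFamilyIdentEqIff (n+2)`, (EQI-(n+3)) ⟺ identically-zero heredity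
  "`E_{n+3} ≡ 0 ⇒ E_{n+2}(U_{−m}) ≡ 0` for some `m`";  `masterFamilyIdentEqIff_all_of_nonvanishing_all`.
So after gen 3 ((T_3) = `masterFamilyIdentEqIff_three`) and gen 6 (the step), the identically-zero master conjecture at order `k`
is EXACTLY (T_k), open for `k ≥ 4`.  No conjecture is asserted; axioms standard. [this work]
-/

noncomputable section

open scoped Classical

namespace Summit.CriticalPhenomena.PercolationContinuityZ3.Theorems

open Finset Function MeasureTheory
open Literature.Combinatorics.Sahi2008
open Literature.Probability.Percolation.DecisionTree (ind)

/-! ### The pointwise statements -/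

/-- **`MasterFamilyEqIff (n+3)` ⟺ "an interior zero of `E_{n+3}` forces a `Z_{n+2}` sub-family"** — every order; families WITH a
zero-flag sub-family are settled by `masterFamily_step_all`. [this work] -/
theorem masterFamilyEqIff_iff_zero_forces_flag (n : ℕ) :
    MasterFamilyEqIff (n + 3) ↔ ∀ (ι : Type) [Fintype ι] (p : ι → unitInterval), (∀ e, (p e : ℝ) ∈ Set.Ioo (0 : ℝ) 1) →
      ∀ U : Fin (n + 3) → Set (Set ι), (∀ j, IsUpperSet (U j)) →
        sahiE (bernoulliWeight p) (n + 3) (fun j => ind (U j)) = 0 →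
          ∃ m : Fin (n + 3), SuppZeroFlag (n + 2) (fun j => U (m.succAbove j)) := by
  refine ⟨fun hE ι _ p hp U hU h0 => ?_, fun hH ι _ p hp U hU => ⟨fun h0 => ?_, masterFamilyEqIff_mpr (n + 3) ι p U⟩⟩
  · obtain ⟨m, hm, -⟩ := (hE ι p hp U hU).1 h0
    exact ⟨m, hm⟩
  · obtain ⟨m, hm⟩ := hH ι p hp U hU h0
    exact ((masterFamily_step_all p U hU m hm).2 hp).1 h0

/-- **`MasterFamilyEqIff (n+3) ↔ MasterFamilyHeredity (n+3)` given only `MasterFamilyEqIff (n+2)`** (no positivity hypothesis;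
compare `masterFamilyEqIff_iff_heredity`). [this work] -/
theorem masterFamilyEqIff_iff_heredity_of_eqIff {n : ℕ} (hE : MasterFamilyEqIff (n + 2)) :
    MasterFamilyEqIff (n + 3) ↔ MasterFamilyHeredity (n + 3) :=
  ⟨masterFamilyHeredity_of_eqIff, fun hH => masterFamilyEqIff_succ_of_heredity hH hE⟩

/-- **Heredity of zeros at every order `≥ 3` implies the pointwise equality conjecture at every order.** [this work] -/
theorem masterFamilyEqIff_all_of_heredity_all (hH : ∀ n, MasterFamilyHeredity (n + 3)) : ∀ k, MasterFamilyEqIff k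
  | 0 => masterFamilyEqIff_of_le_two (Nat.zero_le 2)
  | 1 => masterFamilyEqIff_of_le_two (by norm_num)
  | 2 => masterFamilyEqIff_of_le_two le_rfl
  | n + 3 => masterFamilyEqIff_succ_of_heredity (hH n) (masterFamilyEqIff_all_of_heredity_all hH (n + 2))

/-- **Heredity of zeros at every order `≥ 3` implies Sahi positivity `C_k` for product measures at every order** (via
`masterFamilyNonneg_of_masterFamilyEqIff`). [this work] -/
theorem masterFamilyNonneg_all_of_heredity_all (hH : ∀ n, MasterFamilyHeredity (n + 3)) (k : ℕ) : MasterFamilyNonneg k :=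
  masterFamilyNonneg_of_masterFamilyEqIff (masterFamilyEqIff_all_of_heredity_all hH k)

/-- **Truncated form**: heredity at the orders `3, …, K` gives the pointwise equality conjecture at every order `≤ K`. [this work] -/
theorem masterFamilyEqIff_of_heredity_upTo (K : ℕ) (hH : ∀ n, n + 3 ≤ K → MasterFamilyHeredity (n + 3)) :
    ∀ k, k ≤ K → MasterFamilyEqIff k
  | 0, _ => masterFamilyEqIff_of_le_two (Nat.zero_le 2)
  | 1, _ => masterFamilyEqIff_of_le_two (by norm_num)
  | 2, _ => masterFamilyEqIff_of_le_two le_rfl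
  | n + 3, hk => masterFamilyEqIff_succ_of_heredity (hH n hk)
      (masterFamilyEqIff_of_heredity_upTo K hH (n + 2) (Nat.le_of_succ_le hk))

/-- **Truncated form, positivity**: heredity at the orders `3, …, K` gives `C_k` for product measures at every order `≤ K`
(e.g. `MasterFamilyHeredity 3 ∧ MasterFamilyHeredity 4 ⇒ C_4` for product measures). [this work] -/
theorem masterFamilyNonneg_of_heredity_upTo (K : ℕ) (hH : ∀ n, n + 3 ≤ K → MasterFamilyHeredity (n + 3)) (k : ℕ) (hk : k ≤ K) :
    MasterFamilyNonneg k :=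
  masterFamilyNonneg_of_masterFamilyEqIff (masterFamilyEqIff_of_heredity_upTo K hH k hk)

/-! ### The identically-zero statements -/

/-- **(EQI-(n+3)) ⟺ (T_{n+3})**, every order, no lower-order hypothesis: the identically-zero form `MasterFamilyIdentEqIff (n+3)`
is equivalent to "`n+3` increasing events with NO `Z_{n+2}` sub-family have `E_{n+3}(μ_p) ≠ 0` for some interior `p`" —
families with a `Z_{n+2}` sub-family are settled by `masterFamily_step_all` at the centre of the cube. [this work] -/
theorem masterFamilyIdentEqIff_iff_nonvanishing (n : ℕ) :
    MasterFamilyIdentEqIff (n + 3) ↔ ∀ (ι : Type) [Fintype ι] (U : Fin (n + 3) → Set (Set ι)), (∀ j, IsUpperSet (U j)) →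
      (∀ m : Fin (n + 3), ¬ SuppZeroFlag (n + 2) (fun j => U (m.succAbove j))) →
        ∃ p : ι → unitInterval, (∀ e, (p e : ℝ) ∈ Set.Ioo (0 : ℝ) 1) ∧
          sahiE (bernoulliWeight p) (n + 3) (fun j => ind (U j)) ≠ 0 := by
  constructor
  · intro hI ι _ U hU hno
    by_contra hall
    push Not at hall
    obtain ⟨m, hm, -⟩ := (hI ι U hU).1 fun p hp => hall p hp
    exact hno m hm
  · intro hT ι _ U hU
    refine ⟨fun hall => ?_, fun hZ p _ => masterFamilyIdentEqIff_mpr (n + 3) ι U hZ p⟩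
    by_cases hex : ∃ m : Fin (n + 3), SuppZeroFlag (n + 2) (fun j => U (m.succAbove j))
    · obtain ⟨m, hm⟩ := hex
      exact ((masterFamily_step_all (halfParams ι) U hU m hm).2 (halfParams_mem_Ioo ι)).1
        (hall _ (halfParams_mem_Ioo ι))
    · push Not at hex
      obtain ⟨p, hp, hne⟩ := hT ι U hU hex
      exact absurd (hall p hp) hne

/-- **(EQI-(n+3)) ⟺ identically-zero heredity, given (EQI-(n+2))**: "`E_{n+3}(μ_p; 1_U) = 0` for every interior `p` forces
`E_{n+2}(μ_p; 1_{U_{−m}}) = 0` for every interior `p`, for some slot `m`". [this work] -/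
theorem masterFamilyIdentEqIff_iff_identHeredity {n : ℕ} (hI : MasterFamilyIdentEqIff (n + 2)) :
    MasterFamilyIdentEqIff (n + 3) ↔ ∀ (ι : Type) [Fintype ι] (U : Fin (n + 3) → Set (Set ι)), (∀ j, IsUpperSet (U j)) →
      (∀ p : ι → unitInterval, (∀ e, (p e : ℝ) ∈ Set.Ioo (0 : ℝ) 1) →
          sahiE (bernoulliWeight p) (n + 3) (fun j => ind (U j)) = 0) →
        ∃ m : Fin (n + 3), ∀ p : ι → unitInterval, (∀ e, (p e : ℝ) ∈ Set.Ioo (0 : ℝ) 1) →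
          sahiE (bernoulliWeight p) (n + 2) (fun j => ind (U (m.succAbove j))) = 0 := by
  constructor
  · intro hI3 ι _ U hU hall
    obtain ⟨m, hm, -⟩ := (hI3 ι U hU).1 hall
    exact ⟨m, fun p _ => masterFamilyIdentEqIff_mpr (n + 2) ι _ hm p⟩
  · intro hH ι _ U hU
    refine ⟨fun hall => ?_, fun hZ p _ => masterFamilyIdentEqIff_mpr (n + 3) ι U hZ p⟩
    obtain ⟨m, hm⟩ := hH ι U hU hall
    have hZ : SuppZeroFlag (n + 2) (fun j => U (m.succAbove j)) := (hI ι _ fun j => hU _).1 hm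
    exact ((masterFamily_step_all (halfParams ι) U hU m hZ).2 (halfParams_mem_Ioo ι)).1
      (hall _ (halfParams_mem_Ioo ι))

/-- **(T_k) at every order `≥ 3` is the whole identically-zero master conjecture.** [this work] -/
theorem masterFamilyIdentEqIff_all_of_nonvanishing_all
    (hT : ∀ (n : ℕ) (ι : Type) [Fintype ι] (U : Fin (n + 3) → Set (Set ι)), (∀ j, IsUpperSet (U j)) →
      (∀ m : Fin (n + 3), ¬ SuppZeroFlag (n + 2) (fun j => U (m.succAbove j))) →
        ∃ p : ι → unitInterval, (∀ e, (p e : ℝ) ∈ Set.Ioo (0 : ℝ) 1) ∧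
          sahiE (bernoulliWeight p) (n + 3) (fun j => ind (U j)) ≠ 0) :
    ∀ k, MasterFamilyIdentEqIff k
  | 0 => masterFamilyIdentEqIff_of_le_two (Nat.zero_le 2)
  | 1 => masterFamilyIdentEqIff_of_le_two (by norm_num)
  | 2 => masterFamilyIdentEqIff_of_le_two le_rfl
  | n + 3 => (masterFamilyIdentEqIff_iff_nonvanishing n).2 (hT n)

/-- **The pointwise conjecture at order `n+3` implies (T_{n+3})** (`MasterFamilyEqIff ⇒ MasterFamilyIdentEqIff ⇔ (T)`). [this work] -/
theorem nonvanishing_of_masterFamilyEqIff {n : ℕ} (hE : MasterFamilyEqIff (n + 3)) (ι : Type) [Fintype ι]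
    (U : Fin (n + 3) → Set (Set ι)) (hU : ∀ j, IsUpperSet (U j))
    (hno : ∀ m : Fin (n + 3), ¬ SuppZeroFlag (n + 2) (fun j => U (m.succAbove j))) :
    ∃ p : ι → unitInterval, (∀ e, (p e : ℝ) ∈ Set.Ioo (0 : ℝ) 1) ∧ sahiE (bernoulliWeight p) (n + 3) (fun j => ind (U j)) ≠ 0 :=
  (masterFamilyIdentEqIff_iff_nonvanishing n).1 (masterFamilyIdentEqIff_of_eqIff hE) ι U hU hno

/-- **Sahi positivity on every family with a zero-flag sub-family, every order, closed cube** — the positivity half of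
`masterFamily_step_all`, restated in the shape of `sahiE_ind_nonneg_of_subfamily` without its `MasterFamilyNonneg` hypothesis.
[this work] -/
theorem sahiE_ind_nonneg_of_subfamily_all {ι : Type} [Fintype ι] (p : ι → unitInterval) {n : ℕ}
    (U : Fin (n + 3) → Set (Set ι)) (hU : ∀ j, IsUpperSet (U j)) (m : Fin (n + 3))
    (hZ : SuppZeroFlag (n + 2) (fun j => U (m.succAbove j))) :
    0 ≤ sahiE (bernoulliWeight p) (n + 3) (fun j => ind (U j)) :=
  (masterFamily_step_all p U hU m hZ).1

end Summit.CriticalPhenomena.PercolationContinuityZ3.Theorems
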